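import Summits.AtomisticToContinuum.Crystallization.Theorems.ChargedEnergyGapChartDialC
import Literature.Geometry.DiscreteGeometry.SphereNets

/-!
# `ChargedEnergyGap` · the CHART DIAL, part D: COLLAR is energy-free — decomp-a2c lens-3 g37 node «CollarPacking»

Beneath `CollarPricing θ R` (part C, the TRUE-type half of `ChartedChargePricing θ ↔ FAR ∧ COLLAR`).

§1 COLLAR FROM MULTIPLICITY (proved): if every periodic configuration has at most `K` near charted charged motif
   sites per gross charged motif site, then `CollarPricing θ R` holds with `κ = 1`, `C = K` — NO energy input
   (`excess ≥ 0` only).  The Lennard-Jones potential never enters COLLAR.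
§2 COMPARABLE WITNESSES: `NearGrossCmp θ R M Q p` — a gross charged site within `R·nn(p)` whose own scale is at least
   `nn(p)/M`; `motifCCNearCmp`, `CollarCmpPricing θ R M`.
§3 THE PACKING COUNT (proved): `motifCCNearCmp θ R M Q ≤ (1 + 2R²M)³ · motifChargedGross θ Q` for `0 < R`, `0 ≤ M`
   — lattice translates of the near sites around one defect core are `nn/R`-separated points of a ball of radius
   `R·M·nn` (Matoušek's volume bound `SphereNets.card_le_of_separated`, translation invariance `Blocks.nearestDist_transl`,
   `eq_of_sub_mem`).  Hence **`collarCmpPricing_holds : CollarCmpPricing θ R M`** outright.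
§4 THE RESIDUAL OF COLLAR = WITNESS UPGRADE (pure shell geometry, no energy): `UpgradeWitness θ R M R'` — a charted
   charged site near SOME gross charged site is near (radius `R'`) a gross charged site of COMPARABLE scale;
   `collarPricing_of_upgrade`, and the line beneath P becomes `FAR θ R ∧ UpgradeWitness θ R M R' ⟹ P θ`.
-/

noncomputable section

open Literature.MathematicalPhysics.StatisticalMechanics
open Literature.Geometry.DiscreteGeometry
open Summit.AtomisticToContinuum.Crystallization.Theses.PricedLinkCensus
open Summit.AtomisticToContinuum.Crystallization.Theorems.ChargedEnergyGapNegative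
namespace Summit.AtomisticToContinuum.Crystallization.Theorems.ChargedEnergyGapChartDial

/-! ## §1 COLLAR from a multiplicity bound -/

/-- **COLLAR is energy-free**: a multiplicity bound `#near ≤ K · #gross charged` gives `CollarPricing θ R`
(`κ = 1`, `C = K`; only `0 ≤ excess`). -/
theorem collarPricing_of_multiplicity {θ R K : ℝ} (hK : 0 ≤ K)
    (h : ∀ Q : PeriodicConfiguration 3, (motifCCNear θ R Q : ℝ) ≤ K * (motifChargedGross θ Q : ℝ)) :
    CollarPricing θ R :=
  ⟨1, K, one_pos, hK, fun Q => by rw [one_mul]; linarith [h Q, excess_nonneg' Q]⟩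

/-! ## §2 Comparable witnesses -/

/-- `p` is near a defect core OF COMPARABLE SCALE: a gross charged site (read at its motif representative `y`,
translate `y + g`) within `R · nn(p)` with `nn(p) ≤ M · nn(y)`. -/
def NearGrossCmp (θ R M : ℝ) (Q : PeriodicConfiguration 3) (p : Q.points) : Prop :=
  ∃ y : Q.motif, ∃ g ∈ Q.lattice, Charged Q y ∧ ¬ ChartedAt θ Q (pt Q y) ∧
    dist (p : E3) ((y : E3) + g) ≤ R * nn Q p ∧ nn Q p ≤ M * nn Q (pt Q y)

/-- A comparable witness is a witness. -/
theorem nearGross_of_cmp {θ R M : ℝ} {Q : PeriodicConfiguration 3} {p : Q.points}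
    (h : NearGrossCmp θ R M Q p) : NearGross θ R Q p := by
  obtain ⟨y, g, hg, hC, hU, hd, -⟩ := h
  exact ⟨y, g, hg, hC, hU, hd⟩

/-- charted charged motif sites near a defect core of comparable scale. -/
def motifCCNearCmp (θ R M : ℝ) (Q : PeriodicConfiguration 3) : ℕ :=
  Nat.card {x : Q.motif // (Charged Q x ∧ ChartedAt θ Q (pt Q x)) ∧ NearGrossCmp θ R M Q (pt Q x)}

/-- `#near-comparable ≤ #near`. -/
theorem motifCCNearCmp_le_near (θ R M : ℝ) (Q : PeriodicConfiguration 3) :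
    motifCCNearCmp θ R M Q ≤ motifCCNear θ R Q :=
  Nat.card_le_card_of_injective
    (fun x : {x : Q.motif // (Charged Q x ∧ ChartedAt θ Q (pt Q x)) ∧ NearGrossCmp θ R M Q (pt Q x)} =>
      (⟨x.1, x.2.1, nearGross_of_cmp x.2.2⟩ :
        {x : Q.motif // (Charged Q x ∧ ChartedAt θ Q (pt Q x)) ∧ NearGross θ R Q (pt Q x)}))
    (fun a b hab => Subtype.ext (by simpa using congrArg Subtype.val hab))

/-- piece COLLAR-CMP · PROVED (`collarCmpPricing_holds`, §3): pricing of the near sites with a comparable witness. -/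
def CollarCmpPricing (θ R M : ℝ) : Prop :=
  ∃ κ C : ℝ, 0 < κ ∧ 0 ≤ C ∧ ∀ Q : PeriodicConfiguration 3,
    κ * (motifCCNearCmp θ R M Q : ℝ) ≤ excess Q + C * (motifChargedGross θ Q : ℝ)

/-! ## §3 The packing count -/

section packing

variable (Q : PeriodicConfiguration 3)

/-- The lattice translate `x − g` of a motif site, as a point of `Q`. -/
def shiftPt (x : Q.motif) {g : E3} (hg : g ∈ Q.lattice) : Q.points :=
  Blocks.transl Q (Q.lattice.neg_mem hg) (pt Q x)

/-- The translate's coordinates. -/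
theorem shiftPt_val (x : Q.motif) {g : E3} (hg : g ∈ Q.lattice) :
    (shiftPt Q x hg : E3) = (x : E3) - g := by
  simp [shiftPt, Blocks.transl, sub_eq_add_neg]

/-- Translation invariance of the own scale. -/
theorem nn_shiftPt (x : Q.motif) {g : E3} (hg : g ∈ Q.lattice) :
    nn Q (shiftPt Q x hg) = nn Q (pt Q x) :=
  Blocks.nearestDist_transl Q (Q.lattice.neg_mem hg) (pt Q x)

/-- A charted site's translate is never an uncharted motif site. -/
theorem shiftPt_ne_of_charted {θ : ℝ} {x y : Q.motif} (hx : ChartedAt θ Q (pt Q x))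
    (hy : ¬ ChartedAt θ Q (pt Q y)) {g : E3} (hg : g ∈ Q.lattice) : shiftPt Q x hg ≠ pt Q y := by
  intro h
  have hv : (x : E3) - g = (y : E3) := by simpa [shiftPt_val] using congrArg Subtype.val h
  have hxy : (x : E3) = (y : E3) :=
    Q.eq_of_sub_mem x.1 x.2 y.1 y.2 (by rw [show (x : E3) - y = g by rw [← hv]; abel]; exact hg)
  rw [show pt Q x = pt Q y from Subtype.ext hxy] at hx
  exact hy hx

/-- The core's scale is below the distance to any near charted site's translate: `nn(y) ≤ dist x (y + g)`. -/
theorem nn_le_dist_of_charted {θ : ℝ} {x y : Q.motif} (hx : ChartedAt θ Q (pt Q x))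
    (hy : ¬ ChartedAt θ Q (pt Q y)) {g : E3} (hg : g ∈ Q.lattice) :
    nn Q (pt Q y) ≤ dist (x : E3) ((y : E3) + g) := by
  have h := nearestDist_le_dist (Subtype.val : Q.points → E3) (j := pt Q y) (k := shiftPt Q x hg)
    (shiftPt_ne_of_charted Q hx hy hg)
  rw [shiftPt_val, dist_comm, dist_sub_eq_dist_add_left] at h
  exact h

/-- **THE PACKING COUNT**: `#near-comparable ≤ (1 + 2R²M)³ · #gross charged`. -/
theorem motifCCNearCmp_le {θ R M : ℝ} (hR : 0 < R) (hM : 0 ≤ M) :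
    (motifCCNearCmp θ R M Q : ℝ) ≤ (1 + 2 * R ^ 2 * M) ^ 3 * (motifChargedGross θ Q : ℝ) := by
  classical
  haveI : Nonempty Q.motif := ⟨⟨_, Q.motif_nonempty.choose_spec⟩⟩
  set S : Finset Q.motif := Finset.univ.filter fun x =>
    (Charged Q x ∧ ChartedAt θ Q (pt Q x)) ∧ NearGrossCmp θ R M Q (pt Q x) with hSdef
  set G : Finset Q.motif := Finset.univ.filter fun y => Charged Q y ∧ ¬ ChartedAt θ Q (pt Q y) with hGdef
  have hS : motifCCNearCmp θ R M Q = S.card := by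
    rw [motifCCNearCmp, ← Nat.card_eq_finsetCard]
    exact Nat.card_congr (Equiv.subtypeEquivRight fun x => by simp [hSdef])
  have hG : motifChargedGross θ Q = G.card := by
    rw [motifChargedGross, ← Nat.card_eq_finsetCard]
    exact Nat.card_congr (Equiv.subtypeEquivRight fun x => by simp [hGdef])
  have hmemS : ∀ x, x ∈ S ↔ (Charged Q x ∧ ChartedAt θ Q (pt Q x)) ∧ NearGrossCmp θ R M Q (pt Q x) := fun x => by
    simp [hSdef]
  have hmemG : ∀ y, y ∈ G ↔ Charged Q y ∧ ¬ ChartedAt θ Q (pt Q y) := fun y => by simp [hGdef]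
  -- witnesses
  have hw : ∀ x : Q.motif, x ∈ S → ∃ y : Q.motif, ∃ g : E3, g ∈ Q.lattice ∧ Charged Q y ∧ ¬ ChartedAt θ Q (pt Q y) ∧
      dist (x : E3) ((y : E3) + g) ≤ R * nn Q (pt Q x) ∧ nn Q (pt Q x) ≤ M * nn Q (pt Q y) := by
    intro x hx
    obtain ⟨y, g, hg, hC, hU, hd, hm⟩ := ((hmemS x).1 hx).2
    exact ⟨y, g, hg, hC, hU, hd, hm⟩
  choose! wy wg hL hC hU hd hm using hw
  have hmaps : ∀ x ∈ S, wy x ∈ G := fun x hx => (hmemG _).2 ⟨hC x hx, hU x hx⟩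
  -- fibre bound
  have hfib : ∀ y ∈ G, (((S.filter fun x => wy x = y).card : ℕ) : ℝ) ≤ (1 + 2 * R ^ 2 * M) ^ 3 := by
    intro y hy
    have hyU : ¬ ChartedAt θ Q (pt Q y) := ((hmemG y).1 hy).2
    set Fib := S.filter fun x => wy x = y with hFib
    have hmemF : ∀ x, x ∈ Fib → x ∈ S ∧ wy x = y := fun x hx => by simpa [hFib] using hx
    have hnn : 0 < nn Q (pt Q y) := Blocks.nearestDist_pt_pos Q _
    -- scale comparison for fibre elements
    have hK3 : ∀ x, x ∈ Fib → nn Q (pt Q y) / R ≤ nn Q (pt Q x) := by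
      intro x hx
      obtain ⟨hxS, hxy⟩ := hmemF x hx
      have h1 := hd x hxS; have h2 := nn_le_dist_of_charted Q ((hmemS x).1 hxS).1.2 (hU x hxS) (hL x hxS)
      rw [hxy] at h1 h2
      rw [div_le_iff₀ hR]; linarith
    let φ : Q.motif → E3 := fun x => (x : E3) - wg x - (y : E3)
    have hφ : ∀ x₁ x₂ : Q.motif, φ x₁ - φ x₂ = ((x₁ : E3) - wg x₁) - ((x₂ : E3) - wg x₂) := fun x₁ x₂ => by
      simp only [φ]; abel
    -- distinct fibre elements give distinct, well separated translates
    have hsep : ∀ x₁, x₁ ∈ Fib → ∀ x₂, x₂ ∈ Fib → x₁ ≠ x₂ → nn Q (pt Q y) / R ≤ ‖φ x₁ - φ x₂‖ := by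
      intro x₁ h₁ x₂ h₂ hne
      obtain ⟨h₁S, -⟩ := hmemF x₁ h₁
      obtain ⟨h₂S, -⟩ := hmemF x₂ h₂
      have hp : shiftPt Q x₁ (hL x₁ h₁S) ≠ shiftPt Q x₂ (hL x₂ h₂S) := by
        intro h
        have hv : (x₁ : E3) - wg x₁ = (x₂ : E3) - wg x₂ := by
          simpa [shiftPt_val] using congrArg Subtype.val h
        have hd' : (x₁ : E3) - x₂ = wg x₁ - wg x₂ := by rw [sub_eq_sub_iff_sub_eq_sub] at hv; exact hv
        have : (x₁ : E3) = x₂ :=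
          Q.eq_of_sub_mem x₁.1 x₁.2 x₂.1 x₂.2 (by rw [hd']; exact Q.lattice.sub_mem (hL x₁ h₁S) (hL x₂ h₂S))
        exact hne (Subtype.ext this)
      have hle := nearestDist_le_dist (Subtype.val : Q.points → E3) (j := shiftPt Q x₁ (hL x₁ h₁S))
        (k := shiftPt Q x₂ (hL x₂ h₂S)) hp.symm
      have e : ‖φ x₁ - φ x₂‖ = dist ((shiftPt Q x₁ (hL x₁ h₁S) : Q.points) : E3) (shiftPt Q x₂ (hL x₂ h₂S)) := by
        rw [hφ, shiftPt_val, shiftPt_val, dist_eq_norm]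
      rw [e]
      calc nn Q (pt Q y) / R ≤ nn Q (pt Q x₁) := hK3 x₁ h₁
        _ = nn Q (shiftPt Q x₁ (hL x₁ h₁S)) := (nn_shiftPt Q x₁ _).symm
        _ ≤ _ := hle
    have hinj : Set.InjOn φ (Fib : Set Q.motif) := by
      intro x₁ h₁ x₂ h₂ h
      by_contra hne
      have := hsep x₁ h₁ x₂ h₂ hne
      rw [h, sub_self, norm_zero] at this
      have : 0 < nn Q (pt Q y) / R := by positivity
      linarith
    have hcard : (Fib.image φ).card = Fib.card := Finset.card_image_of_injOn hinj
    have hs : ∀ c ∈ Fib.image φ, ‖c‖ ≤ R * M * nn Q (pt Q y) := by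
      intro c hc
      obtain ⟨x, hx, rfl⟩ := Finset.mem_image.1 hc
      obtain ⟨hxS, hxy⟩ := hmemF x hx
      have h1 := hd x hxS; have h2 := hm x hxS
      rw [hxy] at h1 h2
      calc ‖(x : E3) - wg x - y‖ = dist (x : E3) ((y : E3) + wg x) := by
              rw [dist_eq_norm]; congr 1; abel
        _ ≤ R * nn Q (pt Q x) := h1
        _ ≤ R * (M * nn Q (pt Q y)) := mul_le_mul_of_nonneg_left h2 hR.le
        _ = R * M * nn Q (pt Q y) := by ring
    have hsep' : ∀ c ∈ Fib.image φ, ∀ d ∈ Fib.image φ, c ≠ d → nn Q (pt Q y) / R ≤ ‖c - d‖ := by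
      intro c hc d hd' hcd
      obtain ⟨x₁, h₁, rfl⟩ := Finset.mem_image.1 hc
      obtain ⟨x₂, h₂, rfl⟩ := Finset.mem_image.1 hd'
      exact hsep x₁ h₁ x₂ h₂ (fun h => hcd (by rw [h]))
    have key := SphereNets.card_le_of_separated (Fib.image φ) (R := R * M * nn Q (pt Q y)) (η := nn Q (pt Q y) / R)
      (by positivity) (by positivity) hs hsep'
    rw [hcard, finrank_euclideanSpace_fin] at key
    have e : (1 : ℝ) + 2 * (R * M * nn Q (pt Q y)) / (nn Q (pt Q y) / R) = 1 + 2 * R ^ 2 * M := by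
      field_simp
    rwa [e] at key
  -- assemble
  have hsum := Finset.card_eq_sum_card_fiberwise hmaps
  rw [hS, hG, hsum]
  push_cast
  calc ∑ y ∈ G, (((S.filter fun x => wy x = y).card : ℕ) : ℝ) ≤ ∑ y ∈ G, (1 + 2 * R ^ 2 * M) ^ 3 :=
        Finset.sum_le_sum hfib
    _ = (1 + 2 * R ^ 2 * M) ^ 3 * (G.card : ℝ) := by rw [Finset.sum_const, nsmul_eq_mul, mul_comm]

end packing

/-- **COLLAR-CMP holds** (`κ = 1`, `C = (1 + 2R²M)³`; no energy). -/
theorem collarCmpPricing_holds {θ R M : ℝ} (hR : 0 < R) (hM : 0 ≤ M) : CollarCmpPricing θ R M :=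
  ⟨1, (1 + 2 * R ^ 2 * M) ^ 3, one_pos, by positivity, fun Q => by
    rw [one_mul]; linarith [motifCCNearCmp_le Q (θ := θ) hR hM, excess_nonneg' Q]⟩

/-! ## §4 The residual of COLLAR: witness upgrade (pure geometry) -/

/-- piece UPGRADE · GEOMETRIC (no energy) · TRUE-type expected · M/L (shell combinatorics: a tiny-scale point inside a
charted environment of scale `s` spoils some scale-comparable shell — a 13th point within `6/5·nn`, or a broken
`1 %`-bond after rescaling; covering radius of `3/20`-distorted kissing shells `< 6/5`).  Why it might fail: the
comparable-scale neighbours of the tiny core could all be charge-free UNCHARTED shells (the aside `ChargeFreeCharted θ`),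
which are neither witnesses nor charted.  **Witness upgrade**: a charted charged motif site near (radius `R`) some gross
charged site is near (radius `R'`) a gross charged site of scale `≥ nn/M`. -/
def UpgradeWitness (θ R M R' : ℝ) : Prop :=
  ∀ (Q : PeriodicConfiguration 3) (x : Q.motif), Charged Q x → ChartedAt θ Q (pt Q x) →
    NearGross θ R Q (pt Q x) → NearGrossCmp θ R' M Q (pt Q x)

/-- Under UPGRADE every near site has a comparable witness at radius `R'`. -/
theorem motifCCNear_le_cmp_of_upgrade {θ R M R' : ℝ} (hU : UpgradeWitness θ R M R') (Q : PeriodicConfiguration 3) :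
    motifCCNear θ R Q ≤ motifCCNearCmp θ R' M Q :=
  Nat.card_le_card_of_injective
    (fun x : {x : Q.motif // (Charged Q x ∧ ChartedAt θ Q (pt Q x)) ∧ NearGross θ R Q (pt Q x)} =>
      (⟨x.1, x.2.1, hU Q x.1 x.2.1.1 x.2.1.2 x.2.2⟩ :
        {x : Q.motif // (Charged Q x ∧ ChartedAt θ Q (pt Q x)) ∧ NearGrossCmp θ R' M Q (pt Q x)}))
    (fun a b hab => Subtype.ext (by simpa using congrArg Subtype.val hab))

/-- **GLUE**: UPGRADE gives COLLAR (energy-free, via the packing count at radius `R'`). -/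
theorem collarPricing_of_upgrade {θ R M R' : ℝ} (hR' : 0 < R') (hM : 0 ≤ M) (hU : UpgradeWitness θ R M R') :
    CollarPricing θ R := by
  refine collarPricing_of_multiplicity (K := (1 + 2 * R' ^ 2 * M) ^ 3) (by positivity) fun Q => ?_
  have h1 : (motifCCNear θ R Q : ℝ) ≤ motifCCNearCmp θ R' M Q := by exact_mod_cast motifCCNear_le_cmp_of_upgrade hU Q
  exact h1.trans (motifCCNearCmp_le Q hR' hM)

/-- **The line beneath P after parts C–D**: `FAR θ R ∧ UPGRADE θ R M R' ⟹ ChartedChargePricing θ` — the elastic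
far field and one geometric lemma; COLLAR's packing is discharged. -/
theorem chartedChargePricing_of_far_upgrade {θ R M R' : ℝ} (hR' : 0 < R') (hM : 0 ≤ M)
    (hF : FarFieldPricing θ R) (hU : UpgradeWitness θ R M R') : ChartedChargePricing θ :=
  chartedChargePricing_of_far_collar hF (collarPricing_of_upgrade hR' hM hU)

/-- UPGRADE is monotone in `R'` and `M` (bigger search radius / scale ratio is weaker). -/
theorem upgradeWitness_mono {θ R M M' R' R'' : ℝ} (hM : M ≤ M') (hR : R' ≤ R'') (h : UpgradeWitness θ R M R') :
    UpgradeWitness θ R M' R'' := by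
  intro Q x hc hx hn
  obtain ⟨y, g, hg, hC, hU, hd, hm⟩ := h Q x hc hx hn
  refine ⟨y, g, hg, hC, hU, hd.trans (mul_le_mul_of_nonneg_right hR (nearestDist_nonneg _ _)),
    hm.trans (mul_le_mul_of_nonneg_right hM (nearestDist_nonneg _ _))⟩

end Summit.AtomisticToContinuum.Crystallization.Theorems.ChargedEnergyGapChartDial

end
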